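import Literature.Barriers.AtomisticToContinuum.HalfFillingDischarges
import Literature.MathematicalPhysics.QuantumLattice.DuhamelTwoPoint
import HarnessLib

/-!
# Hard-core lattice bosons at half filling: discharge of (Bᵀ), Kubo's inequality at `T > 0`

`Literature/Barriers/AtomisticToContinuum`; sibling proof file of `HalfFillingThermalKLS.lean`
(item `provefact-Literature.Barriers.AtomisticToContinuum.HalfFillingReflectionPositivity`, fact
(Bᵀ) `hc_kubo_thermal`). No statement is introduced or changed; this file proves

* `hc_kubo_thermal_holds : hc_kubo_thermal` — `|e₃| ≤ e₁ + λ/d` for the thermal bond correlations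
  of the hard-core lattice gas `H = -Σ_{⟨xy⟩}(S¹_xS¹_y + S²_xS²_y) + λΣ_x[½ + (-1)^x S³_x]`
  ([LSSY2005] (11.2)) on the even tori `(ℤ/2kℤ)^d`, `k ≥ 2`, `β > 0`, `λ ≥ 0`.

The argument is Kubo's ([Kubo1988PRL]; [KLS1988PRL] after eq. (4): "otherwise the energy could
be lowered by interchanging the 1 and 3 spin directions"), at positive temperature: for a
unitary `U`, `Z(UHU⋆) = Z(H)` and the Peierls–Bogoliubov inequality give `⟨UHU⋆ - H⟩_H ≥ 0`
(the tree's `Matrix.re_gibbsState_nonneg_of_unitary_conj`, replacing the variational principle of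
the ground-state version `Literature.MathematicalPhysics.QuantumLattice.kubo_xy_bondCorr_abs_le_holds`). With
`U₁ = ⨂ Vᴴ` (`V S³ Vᴴ = S¹`, `V S¹ Vᴴ = -S³`, `V S² Vᴴ = S²`) one gets
`U₁HU₁ᴴ = -Σ_E(b³ + b²) + λΣ_x[½ - (-1)^x S¹_x]`; composing with the `π`-rotation `V²` about the
`2`-axis on the odd sublattice of the bipartite even torus ([DLS1978] §2) flips the sign of the
`b³` bonds. Since `|⟨S^α_x⟩| ≤ ½`, both staggered-field terms have expectation in `[0, |Λ|]`, so
`±Σ_E G³ ≤ Σ_E G¹ + λ|Λ|`; dividing by `d|Λ| = d L^d` (pairs `(x,i)` = edges for `L ≥ 3`) gives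
`|e₃| ≤ e₁ + λ/d`.

## References

* [KLS1988PRL] T. Kennedy, E. H. Lieb, B. S. Shastry, Phys. Rev. Lett. 61 (1988) 2582, after
  eq. (4) (Kubo's inequality `e₁ ≥ |e₃|`).
* [Kubo1988PRL] K. Kubo, Phys. Rev. Lett. 61 (1988) 110.
* [LSSY2005] E. H. Lieb, R. Seiringer, J. P. Solovej, J. Yngvason, *The Mathematics of the Bose
  Gas and its Condensation* (2005), Ch. 11, (11.2) (the Hamiltonian; "without loss of generality
  `λ ≥ 0`"; invariance under rotations about the 3-axis).
* [DLS1978] F. J. Dyson, E. H. Lieb, B. Simon, J. Stat. Phys. 18 (1978) 335, §2 (sublattice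
  rotations on bipartite lattices).
-/

noncomputable section

open Matrix Finset
open Literature.MathematicalPhysics.QuantumLattice
  Literature.MathematicalPhysics.QuantumLattice.SpinOperators Literature.Probability.LatticeModels
open scoped ComplexOrder

namespace Literature.Barriers.AtomisticToContinuum.BoseGas

/-! ### One-site bounds and staggered fields in a Gibbs state -/

section Local

variable {Λ : Type*} [Fintype Λ] [DecidableEq Λ]

/-- `|Re ⟨S^α_x⟩_β| ≤ S` in the Gibbs state of any Hermitian Hamiltonian (`S·1 ∓ S^α_x ≥ 0` and
Gibbs states are positive and normalised). [folklore] -/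
theorem abs_re_gibbsState_siteSpin_le (n : ℕ) {H : Op Λ (n + 1)} (hH : H.IsHermitian) (β : ℝ)
    (x : Λ) (α : Fin 3) :
    |(gibbsState β H (siteSpin n x α)).re| ≤ (n : ℝ) / 2 := by
  have hone : gibbsState β H 1 = 1 := gibbsState_one β H (partitionFn_pos β hH).ne'
  have hre : ((n : ℂ) / 2).re = (n : ℝ) / 2 := by
    rw [show ((n : ℂ) / 2) = (((n : ℝ) / 2 : ℝ) : ℂ) by push_cast; ring, Complex.ofReal_re]
  have hup := gibbsState_nonneg_of_posSemidef β hH (posSemidef_smul_one_sub_siteSpin n x α)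
  rw [map_sub, map_smul, hone, smul_eq_mul, mul_one] at hup
  obtain ⟨hup_re, -⟩ := Complex.nonneg_iff.mp hup
  rw [Complex.sub_re, hre] at hup_re
  have hlo := gibbsState_nonneg_of_posSemidef β hH (posSemidef_smul_one_add_siteSpin n x α)
  rw [map_add, map_smul, hone, smul_eq_mul, mul_one] at hlo
  obtain ⟨hlo_re, -⟩ := Complex.nonneg_iff.mp hlo
  rw [Complex.add_re, hre] at hlo_re
  rw [abs_le]
  constructor <;> linarith

/-- A staggered field `Σ_x (½ + s_x S^α_x)` with real weights `|s_x| ≤ 1` has, for spin ½,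
expectation in `[0, |Λ|]` in every Gibbs state (each term lies in `[0, 1]`). [folklore] -/
theorem re_gibbsState_stagField_mem {H : Op Λ 2} (hH : H.IsHermitian) (β : ℝ) (s : Λ → ℝ)
    (hs : ∀ x, |s x| ≤ 1) (α : Fin 3) :
    0 ≤ (gibbsState β H (∑ x, ((1 / 2 : ℂ) • (1 : Op Λ 2) + (s x : ℂ) • siteSpin 1 x α))).re ∧
      (gibbsState β H (∑ x, ((1 / 2 : ℂ) • (1 : Op Λ 2) + (s x : ℂ) • siteSpin 1 x α))).re ≤
        Fintype.card Λ := by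
  have hone : gibbsState β H 1 = 1 := gibbsState_one β H (partitionFn_pos β hH).ne'
  have hterm : ∀ x, (gibbsState β H ((1 / 2 : ℂ) • (1 : Op Λ 2) + (s x : ℂ) • siteSpin 1 x α)).re =
      1 / 2 + s x * (gibbsState β H (siteSpin 1 x α)).re := by
    intro x
    rw [map_add, map_smul, map_smul, hone, smul_eq_mul, mul_one, smul_eq_mul, Complex.add_re,
      Complex.re_ofReal_mul, show (1 / 2 : ℂ) = ((1 / 2 : ℝ) : ℂ) by push_cast; ring,
      Complex.ofReal_re]
  have hbd : ∀ x, |s x * (gibbsState β H (siteSpin 1 x α)).re| ≤ 1 / 2 := by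
    intro x
    have h := abs_re_gibbsState_siteSpin_le 1 hH β x α
    rw [Nat.cast_one] at h
    rw [abs_mul]
    have : |s x| * |(gibbsState β H (siteSpin 1 x α)).re| ≤ 1 * (1 / 2) :=
      mul_le_mul (hs x) h (abs_nonneg _) zero_le_one
    linarith
  rw [map_sum, Complex.re_sum]
  simp_rw [hterm]
  constructor
  · exact sum_nonneg fun x _ => by have := (abs_le.1 (hbd x)).1; linarith
  · calc ∑ x, (1 / 2 + s x * (gibbsState β H (siteSpin 1 x α)).re) ≤ ∑ _x : Λ, (1 : ℝ) :=
          sum_le_sum fun x _ => by have := (abs_le.1 (hbd x)).2; linarith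
      _ = Fintype.card Λ := by simp

/-- A product unitary maps a staggered field to a staggered field: if `u_x S^α u_xᴴ = τ_x S^{α'}`
at every site then `(⨂u) Σ_x (½ + s_x S^α_x) (⨂u)ᴴ = Σ_x (½ + s_xτ_x S^{α'}_x)`. [folklore] -/
theorem productOp_conj_stagField {n : ℕ} {u : Λ → Matrix (Fin (n + 1)) (Fin (n + 1)) ℂ}
    (hu : ∀ z, u z * (u z)ᴴ = 1) {α α' : Fin 3} {τ : Λ → ℝ}
    (h : ∀ z, u z * spinVec n α * (u z)ᴴ = (τ z : ℂ) • spinVec n α') (s : Λ → ℝ) :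
    productOp u * (∑ x, ((1 / 2 : ℂ) • (1 : Op Λ (n + 1)) + (s x : ℂ) • siteSpin n x α)) *
        (productOp u)ᴴ =
      ∑ x, ((1 / 2 : ℂ) • (1 : Op Λ (n + 1)) + ((s x * τ x : ℝ) : ℂ) • siteSpin n x α') := by
  rw [Finset.mul_sum, Finset.sum_mul]
  refine sum_congr rfl fun x _ => ?_
  rw [Matrix.mul_add, Matrix.add_mul, Matrix.mul_smul, Matrix.smul_mul, Matrix.mul_one,
    productOp_mul_conjTranspose hu, Matrix.mul_smul, Matrix.smul_mul, productOp_conj_siteSpin hu,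
    h, onSite_smul', smul_smul, Complex.ofReal_mul]
  rfl

/-- A product unitary acting diagonally on a spin component rescales the bond operator:
if `u_z S^α u_zᴴ = c_z S^{α'}` at every site then `(⨂u) b^α_{xy} (⨂u)ᴴ = c_x c_y b^{α'}_{xy}`.
[folklore] -/
theorem productOp_conj_spinBond_of_smul {n : ℕ} {u : Λ → Matrix (Fin (n + 1)) (Fin (n + 1)) ℂ}
    (hu : ∀ z, u z * (u z)ᴴ = 1) (hu' : ∀ z, (u z)ᴴ * u z = 1) {α α' : Fin 3} {c : Λ → ℂ}
    (h : ∀ z, u z * spinVec n α * (u z)ᴴ = c z • spinVec n α') (x y : Λ) :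
    productOp u * spinBond n α x y * (productOp u)ᴴ = (c x * c y) • spinBond n α' x y := by
  rw [productOp_conj_spinBond hu hu', h, h, onSite_smul', onSite_smul', smul_mul_smul_comm,
    smul_mul_smul_comm, mul_comm (c y) (c x), ← smul_add, smul_comm, spinBond]
  rfl

end Local

/-! ### Thermal expectations of bond sums for the hard-core lattice gas -/

variable {d : ℕ}

/-- `Re ⟨½(Sᵅ_xSᵅ_y + Sᵅ_ySᵅ_x)⟩_β = G^α(x,y)` (symmetry of the thermal two-point function); a
private copy of `re_gibbsState_spinBond` of the sibling `HalfFillingEnergyProofs.lean`, kept local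
so that this file depends only on `HalfFillingDischarges`. [folklore] -/
private theorem re_gibbsState_spinBond_aux (α : Fin 3) (β : ℝ) (L : ℕ) [NeZero L] (lam : ℝ)
    (x y : TorusSite d L) :
    (gibbsState β (hardCoreLatticeGas d L lam) (spinBond 1 α x y)).re = hcCorr α β L lam x y := by
  have h : ∀ x y : TorusSite d L,
      (gibbsState β (hardCoreLatticeGas d L lam) (siteSpin 1 x α * siteSpin 1 y α)).re =
        hcCorr α β L lam x y := fun x y => by rw [hcCorr_of_neZero, thermalCorr]
  rw [spinBond, map_smul, map_add, smul_eq_mul,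
    show (1 / 2 : ℂ) = ((1 / 2 : ℝ) : ℂ) by push_cast; ring, Complex.re_ofReal_mul,
    Complex.add_re, h, h, hcCorr_symm α β L lam y x]
  ring

/-- The Gibbs state of the hard-core gas on an "XXZ-type" bond sum with real weights:
`Re ⟨Σ_E (a b⁰ + b b¹ + c b²)⟩_β = a Σ_E G⁰ + b Σ_E G¹ + c Σ_E G²`. [folklore] -/
theorem re_gibbsState_bondSum (β : ℝ) (L : ℕ) [NeZero L] (lam : ℝ) (a b c : ℝ) :
    (gibbsState β (hardCoreLatticeGas d L lam) (∑ e ∈ (torusGraph d L).edgeFinset,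
      Sym2.lift ⟨fun x y => (a : ℂ) • spinBond 1 0 x y + (b : ℂ) • spinBond 1 1 x y +
        (c : ℂ) • spinBond 1 2 x y, fun x y => by simp only [spinBond_comm]⟩ e)).re =
      a * ∑ e ∈ (torusGraph d L).edgeFinset, Sym2.lift
          ⟨fun x y => hcCorr 0 β L lam x y, fun x y => hcCorr_symm 0 β L lam x y⟩ e +
      b * ∑ e ∈ (torusGraph d L).edgeFinset, Sym2.lift
          ⟨fun x y => hcCorr 1 β L lam x y, fun x y => hcCorr_symm 1 β L lam x y⟩ e +
      c * ∑ e ∈ (torusGraph d L).edgeFinset, Sym2.lift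
          ⟨fun x y => hcCorr 2 β L lam x y, fun x y => hcCorr_symm 2 β L lam x y⟩ e := by
  rw [map_sum, Complex.re_sum, mul_sum, mul_sum, mul_sum, ← sum_add_distrib, ← sum_add_distrib]
  refine sum_congr rfl fun e _ => ?_
  induction e using Sym2.ind with
  | h x y =>
    simp only [Sym2.lift_mk, map_add, map_smul, smul_eq_mul, Complex.add_re,
      Complex.re_ofReal_mul, re_gibbsState_spinBond_aux]

/-- The hard-core lattice gas as a weighted bond sum plus the staggered field with real signs
`(-1)^x`: `H = Σ_E(-b⁰ - b¹ + 0·b²) + λ Σ_x (½ + (-1)^x S³_x)`. [cite: LSSY2005, Ch. 11 (11.2)] -/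
theorem hardCoreLatticeGas_eq_bondSum_add (L : ℕ) [NeZero L] (lam : ℝ) :
    hardCoreLatticeGas d L lam =
      (∑ e ∈ (torusGraph d L).edgeFinset,
        Sym2.lift ⟨fun x y => ((-1 : ℝ) : ℂ) • spinBond 1 0 x y + ((-1 : ℝ) : ℂ) • spinBond 1 1 x y +
          ((0 : ℝ) : ℂ) • spinBond 1 2 x y, fun x y => by simp only [spinBond_comm]⟩ e) +
      (lam : ℂ) • ∑ x : TorusSite d L, ((1 / 2 : ℂ) • (1 : Op (TorusSite d L) 2) +
        (((-1 : ℝ) ^ (∑ i, (x i).val) : ℝ) : ℂ) • siteSpin 1 x 2) := by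
  rw [hardCoreLatticeGas_eq, xyTorus_eq_bondSum]
  simp only [Complex.ofReal_pow, Complex.ofReal_neg, Complex.ofReal_one]

/-! ### The core inequality: one unitary, one sign -/

/-- **Kubo's mechanism at positive temperature.** Let `w` be a family of one-site unitaries
with `w_z S¹ w_zᴴ = σ_z S³`, `w_z S² w_zᴴ = S²`, `w_z S³ w_zᴴ = τ_z S¹` (`|τ_z| ≤ 1`) and
`σ_xσ_y = s₀` on every edge of the torus. Then `U = ⨂w` maps `H` to
`Σ_E(-s₀ b² - b¹) + λΣ_x(½ + (-1)^xτ_x S¹_x)`, and `⟨UHUᴴ - H⟩_H ≥ 0` (Peierls–Bogoliubov,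
`Z(UHUᴴ) = Z(H)`) reads `s₀ Σ_E G² ≤ Σ_E G⁰ + λ L^d`. [cite: KLS1988PRL, after eq. (4)]
[cite: Kubo1988PRL] -/
theorem kubo_core (L : ℕ) [NeZero L] {β : ℝ} (hβ : 0 < β) {lam : ℝ} (hlam : 0 ≤ lam)
    {w : TorusSite d L → Matrix (Fin 2) (Fin 2) ℂ} (hw : ∀ z, w z * (w z)ᴴ = 1)
    (hw' : ∀ z, (w z)ᴴ * w z = 1) {σ τ : TorusSite d L → ℝ} (hτ : ∀ z, |τ z| ≤ 1)
    (h0 : ∀ z, w z * spinX 1 * (w z)ᴴ = (σ z : ℂ) • SpinOperators.spinZ 1)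
    (h1 : ∀ z, w z * spinY 1 * (w z)ᴴ = spinY 1)
    (h2 : ∀ z, w z * SpinOperators.spinZ 1 * (w z)ᴴ = (τ z : ℂ) • spinX 1)
    {s₀ : ℝ} (hσ : ∀ x y, (torusGraph d L).Adj x y → σ x * σ y = s₀) :
    s₀ * ∑ e ∈ (torusGraph d L).edgeFinset,
        Sym2.lift ⟨fun x y => hcCorr 2 β L lam x y, fun x y => hcCorr_symm 2 β L lam x y⟩ e ≤
      ∑ e ∈ (torusGraph d L).edgeFinset,
        Sym2.lift ⟨fun x y => hcCorr 0 β L lam x y, fun x y => hcCorr_symm 0 β L lam x y⟩ e +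
      lam * (L : ℝ) ^ d := by
  set E := (torusGraph d L).edgeFinset with hE
  set g : Fin 3 → Sym2 (TorusSite d L) → ℝ := fun α =>
    Sym2.lift ⟨fun x y => hcCorr α β L lam x y, fun x y => hcCorr_symm α β L lam x y⟩ with hg
  set H := hardCoreLatticeGas d L lam with hH
  have hHerm : H.IsHermitian := hardCoreLatticeGas_isHermitian d L lam
  -- bond sums and staggered fields
  set B : ℝ → ℝ → ℝ → Op (TorusSite d L) 2 := fun a b c =>
    ∑ e ∈ E, Sym2.lift ⟨fun x y => (a : ℂ) • spinBond 1 0 x y + (b : ℂ) • spinBond 1 1 x y +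
      (c : ℂ) • spinBond 1 2 x y, fun x y => by simp only [spinBond_comm]⟩ e with hB
  set F : (TorusSite d L → ℝ) → Fin 3 → Op (TorusSite d L) 2 := fun s α =>
    ∑ x, ((1 / 2 : ℂ) • (1 : Op (TorusSite d L) 2) + (s x : ℂ) • siteSpin 1 x α) with hF
  set c : TorusSite d L → ℝ := fun x => (-1 : ℝ) ^ (∑ i, (x i).val) with hc
  have hc1 : ∀ x, |c x| ≤ 1 := fun x => by rw [hc, abs_pow, abs_neg, abs_one, one_pow]
  have hcτ : ∀ x, |c x * τ x| ≤ 1 := fun x => by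
    rw [abs_mul]; exact mul_le_one₀ (hc1 x) (abs_nonneg _) (hτ x)
  have hHB : H = B (-1) (-1) 0 + (lam : ℂ) • F c 2 := hardCoreLatticeGas_eq_bondSum_add L lam
  have hωB : ∀ a b c' : ℝ, (gibbsState β H (B a b c')).re =
      a * ∑ e ∈ E, g 0 e + b * ∑ e ∈ E, g 1 e + c' * ∑ e ∈ E, g 2 e :=
    fun a b c' => re_gibbsState_bondSum β L lam a b c'
  -- conjugating the bonds
  have hb0 : ∀ x y, productOp w * spinBond 1 0 x y * (productOp w)ᴴ =
      ((σ x : ℂ) * σ y) • spinBond 1 2 x y :=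
    productOp_conj_spinBond_of_smul hw hw' (α := 0) (α' := 2)
      (fun z => by rw [spinVec_zero, spinVec_two, h0])
  have hb1 : ∀ x y, productOp w * spinBond 1 1 x y * (productOp w)ᴴ = spinBond 1 1 x y := by
    intro x y
    rw [productOp_conj_spinBond_of_smul hw hw' (α := 1) (α' := 1) (c := fun _ => (1 : ℂ))
      (fun z => by rw [spinVec_one, h1, one_smul]) x y, one_mul, one_smul]
  have hUB : productOp w * B (-1) (-1) 0 * (productOp w)ᴴ = B 0 (-1) (-s₀) := by
    rw [hB]
    simp only [Finset.mul_sum, Finset.sum_mul]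
    refine sum_congr rfl fun e he => ?_
    induction e using Sym2.ind with
    | h x y =>
      have hadj : (torusGraph d L).Adj x y := by rwa [hE, SimpleGraph.mem_edgeFinset] at he
      have hs : (σ x : ℂ) * σ y = s₀ := by rw [← Complex.ofReal_mul, hσ x y hadj]
      simp only [Sym2.lift_mk, Matrix.mul_add, Matrix.add_mul, Matrix.mul_smul, Matrix.smul_mul,
        Complex.ofReal_zero, zero_smul, add_zero, zero_add, hb0, hb1, hs, smul_smul]
      simp only [Complex.ofReal_neg, Complex.ofReal_one, neg_one_mul, neg_smul, one_smul]
      abel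
  -- conjugating the staggered field
  have hUF : productOp w * F c 2 * (productOp w)ᴴ = F (fun x => c x * τ x) 0 := by
    rw [hF]
    exact productOp_conj_stagField hw (α := 2) (α' := 0)
      (fun z => by rw [spinVec_two, spinVec_zero, h2]) c
  have hUH : productOp w * H * (productOp w)ᴴ =
      B 0 (-1) (-s₀) + (lam : ℂ) • F (fun x => c x * τ x) 0 := by
    rw [hHB, Matrix.mul_add, Matrix.add_mul, hUB, Matrix.mul_smul, Matrix.smul_mul, hUF]
  -- the Peierls–Bogoliubov inequality for the unitary image
  have hUmem : productOp w ∈ Matrix.unitaryGroup (TensorIndex (TorusSite d L) 2) ℂ :=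
    Matrix.mem_unitaryGroup_iff.2 (productOp_mul_conjTranspose hw)
  have hPB := re_gibbsState_nonneg_of_unitary_conj hHerm hβ hUmem
    ((isHermitian_mul_mul_conjTranspose (productOp w) hHerm).sub hHerm)
    (show productOp w * H * star (productOp w) = H + (productOp w * H * (productOp w)ᴴ - H) by
      rw [star_eq_conjTranspose]; abel)
  -- evaluating both expectations
  have hR1 : (gibbsState β H (productOp w * H * (productOp w)ᴴ)).re =
      -(∑ e ∈ E, g 1 e) - s₀ * ∑ e ∈ E, g 2 e +
        lam * (gibbsState β H (F (fun x => c x * τ x) 0)).re := by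
    rw [hUH, map_add, map_smul, Complex.add_re, smul_eq_mul, Complex.re_ofReal_mul, hωB]
    ring
  have hR2 : (gibbsState β H H).re =
      -(∑ e ∈ E, g 0 e) - (∑ e ∈ E, g 1 e) + lam * (gibbsState β H (F c 2)).re := by
    rw [show gibbsState β H H = gibbsState β H (B (-1) (-1) 0 + (lam : ℂ) • F c 2) by
      rw [← hHB]]
    rw [map_add, map_smul, Complex.add_re, smul_eq_mul, Complex.re_ofReal_mul, hωB]
    ring
  rw [map_sub, Complex.sub_re, hR1, hR2] at hPB
  -- the staggered fields have expectation in `[0, L^d]`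
  have hcard : (Fintype.card (TorusSite d L) : ℝ) = (L : ℝ) ^ d := by
    rw [Fintype.card_pi, prod_const, ZMod.card, card_univ, Fintype.card_fin]
    push_cast
    ring
  have hF1 : (gibbsState β H (F (fun x => c x * τ x) 0)).re ≤ (L : ℝ) ^ d := by
    rw [← hcard, hF]
    exact (re_gibbsState_stagField_mem hHerm β (fun x => c x * τ x) hcτ 0).2
  have hF2 : 0 ≤ (gibbsState β H (F c 2)).re := by
    rw [hF]
    exact (re_gibbsState_stagField_mem hHerm β c hc1 2).1
  have hdiff : lam * ((gibbsState β H (F (fun x => c x * τ x) 0)).re -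
      (gibbsState β H (F c 2)).re) ≤ lam * (L : ℝ) ^ d :=
    mul_le_mul_of_nonneg_left (by linarith) hlam
  linarith

/-! ### Discharge of (Bᵀ) -/

/-- **Discharge of (Bᵀ)** `hc_kubo_thermal`: `|e₃| ≤ e₁ + λ/d` on the even tori `L = 2k ≥ 4`,
`β > 0`, `λ ≥ 0`. `kubo_core` with `U₁ = ⨂Vᴴ` (`σ = 1`, `τ = -1`, `s₀ = 1`) gives
`Σ_E G³ ≤ Σ_E G¹ + λL^d`; with `U₂U₁`, `U₂ = V²` (the `π`-rotation about the `2`-axis) on the odd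
sublattice (`σ = ε`, `τ = -ε`, `ε_xε_y = -1` on edges of the bipartite even torus, `s₀ = -1`) it
gives `-Σ_E G³ ≤ Σ_E G¹ + λL^d`; finally `d L^d e_α = Σ_E G^α` (pairs `(x,i)` versus edges,
`L ≥ 3`). [cite: KLS1988PRL, after eq. (4)] [cite: Kubo1988PRL] [cite: LSSY2005, Ch. 11 (11.2)] -/
theorem hc_kubo_thermal_holds : hc_kubo_thermal := by
  intro d hd k hk β lam hβ hlam
  haveI : NeZero (2 * k) := ⟨by omega⟩
  have hL : 2 ≤ 2 * k := by omega
  have hL2 : 2 * k ≠ 2 := by omega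
  set L := 2 * k with hLdef
  set E := (torusGraph d L).edgeFinset with hE
  set g : Fin 3 → Sym2 (TorusSite d L) → ℝ := fun α =>
    Sym2.lift ⟨fun x y => hcCorr α β L lam x y, fun x y => hcCorr_symm α β L lam x y⟩ with hg
  -- (1) the single-site rotations
  obtain ⟨V, hV, hV', hVz, hVx, hVy⟩ := exists_unitary_conj_spinZ_eq_spinX 1
  have hx : Vᴴ * spinX 1 * V = SpinOperators.spinZ 1 := by
    rw [← hVz, ← mul_assoc, ← mul_assoc, hV', one_mul, mul_assoc, hV', mul_one]
  have hy : Vᴴ * spinY 1 * V = spinY 1 := by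
    conv_lhs => rw [← hVy]
    rw [← mul_assoc, ← mul_assoc, hV', one_mul, mul_assoc, hV', mul_one]
  have hz : Vᴴ * SpinOperators.spinZ 1 * V = -spinX 1 := by
    have h : Vᴴ * (V * spinX 1 * Vᴴ) * V = Vᴴ * (-SpinOperators.spinZ 1) * V := by rw [hVx]
    rw [Matrix.mul_neg, Matrix.neg_mul, show Vᴴ * (V * spinX 1 * Vᴴ) * V =
      Vᴴ * V * spinX 1 * (Vᴴ * V) by simp only [Matrix.mul_assoc], hV', Matrix.one_mul,
      Matrix.mul_one] at h
    rw [h, neg_neg]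
  set R := V * V with hR
  have hRR : R * Rᴴ = 1 := by
    rw [hR, conjTranspose_mul, mul_assoc, ← mul_assoc V Vᴴ, hV, one_mul, hV]
  have hRR' : Rᴴ * R = 1 := by
    rw [hR, conjTranspose_mul, mul_assoc, ← mul_assoc Vᴴ V, hV', one_mul, hV']
  have hRz : R * SpinOperators.spinZ 1 * Rᴴ = -SpinOperators.spinZ 1 := by
    rw [hR, conjTranspose_mul, show V * V * SpinOperators.spinZ 1 * (Vᴴ * Vᴴ) =
      V * (V * SpinOperators.spinZ 1 * Vᴴ) * Vᴴ by simp only [mul_assoc], hVz, hVx]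
  have hRx : R * spinX 1 * Rᴴ = -spinX 1 := by
    rw [hR, conjTranspose_mul, show V * V * spinX 1 * (Vᴴ * Vᴴ) =
      V * (V * spinX 1 * Vᴴ) * Vᴴ by simp only [mul_assoc], hVx, Matrix.mul_neg,
      Matrix.neg_mul, hVz]
  have hRy : R * spinY 1 * Rᴴ = spinY 1 := by
    rw [hR, conjTranspose_mul, show V * V * spinY 1 * (Vᴴ * Vᴴ) =
      V * (V * spinY 1 * Vᴴ) * Vᴴ by simp only [mul_assoc], hVy, hVy]
  -- (2) `U₁ = ⨂ Vᴴ`: `Σ_E G² ≤ Σ_E G⁰ + λ L^d`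
  have hplus : (1 : ℝ) * ∑ e ∈ E, g 2 e ≤ ∑ e ∈ E, g 0 e + lam * (L : ℝ) ^ d := by
    refine kubo_core L hβ hlam (w := fun _ => Vᴴ) (σ := fun _ => 1) (τ := fun _ => -1)
      (fun _ => by rw [conjTranspose_conjTranspose, hV'])
      (fun _ => by rw [conjTranspose_conjTranspose, hV]) (fun _ => by norm_num)
      (fun _ => by rw [conjTranspose_conjTranspose, hx, Complex.ofReal_one, one_smul])
      (fun _ => by rw [conjTranspose_conjTranspose, hy])
      (fun _ => by rw [conjTranspose_conjTranspose, hz, Complex.ofReal_neg, Complex.ofReal_one,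
        neg_one_smul])
      (fun _ _ _ => by norm_num)
  -- (3) the sublattice parity and `U₂U₁`: `-Σ_E G² ≤ Σ_E G⁰ + λ L^d`
  set ε : TorusSite d L → ZMod 2 := fun x =>
    ∑ j, ZMod.castHom (dvd_mul_right 2 k) (ZMod 2) (x j) with hε
  set sgn : TorusSite d L → ℝ := fun z => if ε z = 0 then 1 else -1 with hsgn
  have hsgn1 : ∀ z, |sgn z| ≤ 1 := by
    intro z; simp only [hsgn]; split_ifs <;> norm_num
  have hadj : ∀ x y : TorusSite d L, (torusGraph d L).Adj x y → sgn x * sgn y = -1 := by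
    intro x y hxy
    rw [torusGraph_adj_iff] at hxy
    have h01 : ∀ t : ZMod 2, t = 0 ∨ t = 1 := by decide
    have key : ∀ x' : TorusSite d L, ∀ i, sgn x' * sgn (x' + Pi.single i 1) = -1 := by
      intro x' i
      have hpar : ε (x' + Pi.single i 1) = ε x' + 1 := torusParity_add_single k x' i
      simp only [hsgn, hpar]
      rcases h01 (ε x') with h0 | h1
      · rw [if_pos h0, if_neg (by rw [h0]; decide), one_mul]
      · rw [if_neg (by rw [h1]; decide), if_pos (by rw [h1]; decide), mul_one]
    obtain ⟨-, ⟨i, rfl⟩ | ⟨i, rfl⟩⟩ := hxy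
    · exact key x i
    · rw [mul_comm]; exact key y i
  set u₂ : TorusSite d L → Matrix (Fin 2) (Fin 2) ℂ := fun z => if ε z = 0 then 1 else R with hu₂
  have hu₂a : ∀ z, u₂ z * (u₂ z)ᴴ = 1 := by
    intro z; simp only [hu₂]; split_ifs
    · rw [conjTranspose_one, mul_one]
    · exact hRR
  have hu₂b : ∀ z, (u₂ z)ᴴ * u₂ z = 1 := by
    intro z; simp only [hu₂]; split_ifs
    · rw [conjTranspose_one, mul_one]
    · exact hRR'
  have hu₂x : ∀ z, u₂ z * spinX 1 * (u₂ z)ᴴ = (sgn z : ℂ) • spinX 1 := by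
    intro z; simp only [hu₂, hsgn]; split_ifs
    · rw [conjTranspose_one, mul_one, one_mul, Complex.ofReal_one, one_smul]
    · rw [hRx, Complex.ofReal_neg, Complex.ofReal_one, neg_one_smul]
  have hu₂y : ∀ z, u₂ z * spinY 1 * (u₂ z)ᴴ = spinY 1 := by
    intro z; simp only [hu₂]; split_ifs
    · rw [conjTranspose_one, mul_one, one_mul]
    · exact hRy
  have hu₂z : ∀ z, u₂ z * SpinOperators.spinZ 1 * (u₂ z)ᴴ = (sgn z : ℂ) • SpinOperators.spinZ 1 := by
    intro z; simp only [hu₂, hsgn]; split_ifs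
    · rw [conjTranspose_one, mul_one, one_mul, Complex.ofReal_one, one_smul]
    · rw [hRz, Complex.ofReal_neg, Complex.ofReal_one, neg_one_smul]
  have hconj : ∀ (z : TorusSite d L) (M : Matrix (Fin 2) (Fin 2) ℂ),
      Vᴴ * u₂ z * M * (Vᴴ * u₂ z)ᴴ = Vᴴ * (u₂ z * M * (u₂ z)ᴴ) * V := fun z M => by
    rw [conjTranspose_mul, conjTranspose_conjTranspose]; simp only [Matrix.mul_assoc]
  have hminus : (-1 : ℝ) * ∑ e ∈ E, g 2 e ≤ ∑ e ∈ E, g 0 e + lam * (L : ℝ) ^ d := by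
    refine kubo_core L hβ hlam (w := fun z => Vᴴ * u₂ z) (σ := sgn) (τ := fun z => -sgn z)
      (fun z => by rw [conjTranspose_mul, conjTranspose_conjTranspose, Matrix.mul_assoc,
        ← Matrix.mul_assoc (u₂ z), hu₂a, Matrix.one_mul, hV'])
      (fun z => by rw [conjTranspose_mul, conjTranspose_conjTranspose, Matrix.mul_assoc,
        ← Matrix.mul_assoc V, hV, Matrix.one_mul, hu₂b])
      (fun z => by rw [abs_neg]; exact hsgn1 z)
      (fun z => by rw [hconj, hu₂x, Matrix.mul_smul, Matrix.smul_mul, hx])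
      (fun z => by rw [hconj, hu₂y, hy])
      (fun z => by rw [hconj, hu₂z, Matrix.mul_smul, Matrix.smul_mul, hz, smul_neg, ← neg_smul,
        Complex.ofReal_neg])
      hadj
  -- (4) `|Σ_E G²| ≤ Σ_E G⁰ + λ L^d`, then pairs versus edges
  have habs : |∑ e ∈ E, g 2 e| ≤ ∑ e ∈ E, g 0 e + lam * (L : ℝ) ^ d := by
    rw [abs_le]; constructor <;> linarith
  have h0 := sum_pairs_eq_sum_edgeFinset L hL (g 0)
  have h2 := sum_pairs_eq_sum_edgeFinset L hL (g 2)
  rw [if_neg hL2, one_mul] at h0 h2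
  have hg' : ∀ (α : Fin 3) (x : TorusSite d L) (i : Fin d),
      hcCorr α β L lam x (x + Pi.single i 1) = g α s(x, x + Pi.single i 1) := fun α x i => rfl
  rw [hcBondCorr_of_neZero, hcBondCorr_of_neZero]
  simp_rw [hg']
  rw [h0, h2]
  have hd0 : (0 : ℝ) < d := by exact_mod_cast (show 0 < d by omega)
  have hLd : (0 : ℝ) < (L : ℝ) ^ d := pow_pos (by exact_mod_cast (show 0 < L by omega)) d
  have hpos : (0 : ℝ) < (d : ℝ) * (L : ℝ) ^ d := mul_pos hd0 hLd
  rw [abs_div, abs_of_pos hpos, show lam / d = lam * (L : ℝ) ^ d / ((d : ℝ) * (L : ℝ) ^ d) by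
    rw [mul_div_mul_right _ _ hLd.ne'], ← add_div]
  exact div_le_div_of_nonneg_right habs hpos.le

end Literature.Barriers.AtomisticToContinuum.BoseGas
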